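import Mathlib
import HarnessLib
import Literature.MathematicalPhysics.QuantumLattice.KohnLuttinger
import Literature.MathematicalPhysics.QuantumLattice.FermiRG.FST2Hypotheses
import Summits.HubbardSuperconductivity.HubbardSuperconductivity.Theorems.WeakCouplingBCSKlCertTPrimePHReflectionMeasure
import Summits.HubbardSuperconductivity.HubbardSuperconductivity.Theorems.WeakCouplingBCSKlCertTPrimeConvexity
import Summits.HubbardSuperconductivity.HubbardSuperconductivity.Theorems.WeakCouplingBCSKlCertTPrimeConvexityA3
import Summits.HubbardSuperconductivity.HubbardSuperconductivity.Theorems.WeakCouplingBCSKlCertTPrimeCurvatureQuadratic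

/-!
# WeakCouplingBCS — KL certificate, `t′` rows: the curvature quadratic (far Γ side, the COMPLETE chart, the scan rows)

§5c far Γ side (`−4 − 4t′ < μ < μ_c(t′) = 8t′ − 16t′³`): the curvature quadratic `Q_{t′,μ}` of `…KlCertTPrimeCurvatureQuadratic` is positive
at the axis value `1 + d_ax` and at the diagonal value `2c_d` of `p = cos k₀ + cos k₁`, every curve point has `p` in between, and `Q` is
concave ⇒ `N > 0` along the whole curve (`farGamma_curvNum_pos`, `farGamma_curvSignConstant`, `farGamma_hypA3`).  §5d `convexityChart`
(constant sign below `μ_c(t′)`, inflection on `(μ_c(t′), 4t′)`, constant sign above `4t′`) and the scan rows `Mside_row_tpm03/02/01`,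
`farGamma_row_tpm01`, `hypA3_cell_d0125_tpm03` (the director's first `t′` target `(1/8, −0.3)` satisfies FST II (A3) in the hole orientation).

Honest framing: statements about the one-band dispersion `squareDispersion 1 t′` and the typed hypothesis `FermiRG.HypA3` only; nothing here
asserts a Kohn–Luttinger margin at `t′ ≠ 0`, K₃, the window or superconductivity; a Kohn–Luttinger instability statement is not ODLRO and
nothing here proves superconductivity in the Hubbard model; no `t′ ≠ 0` statement chains to the summit Statement (`squareDispersion 1 0`).

STATUS: reader file of hubbard-klscan-idea-4 ROUND 4 (card «tprime-curvature-quadratic»); the CHECKED form of this text is `r4/Sketch.lean`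
(§§1–5 in one file: farm `lean check` rc 0 · 0 err · 0 warn · 0 sorry, `#print axioms convexityChart` = propext · Classical.choice · Quot.sound);
this module elaborates once its imports (`…KlCertTPrimeConvexity`, `…KlCertTPrimeConvexityA3`) are in the tree. Filing (R286): `--supports
stmt-HubbardSuperconductivity-0158 --as helper`.

References: J. González, F. Guinea, M. A. H. Vozmediano, Phys. Rev. Lett. 79 (1997) 3514 and Int. J. Mod. Phys. B 13 (1999)
(doi:10.1142/s0217979299002526); S. Fratini, F. Guinea, Phys. Rev. B 66 (2002) 125104, App. A; J. Feldman, M. Salmhofer, E. Trubowitz,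
Comm. Pure Appl. Math. 52 (1999) 273, hypothesis (A3) (tree: `FermiRG.FST2Hypotheses`).
-/

noncomputable section

-- the tree's namespace `Summit.<Summit>.<Problem>.Theorems` repeats the summit name by design (D-0017)
set_option linter.dupNamespace false

namespace Summit.HubbardSuperconductivity.HubbardSuperconductivity.Theorems.KlTPrimeConvexity

open Real Set Literature.MathematicalPhysics.QuantumLattice

/-! #### §5c  Far Γ side: concavity between the axis value and the diagonal value -/

/-- A concave quadratic on a segment is bounded below by its smaller endpoint value. [folklore] -/
theorem quad_ge_min_of_concave {A B C a b p : ℝ} (hA : A ≤ 0) (hap : a ≤ p) (hpb : p ≤ b) :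
    min (A * a ^ 2 + B * a + C) (A * b ^ 2 + B * b + C) ≤ A * p ^ 2 + B * p + C := by
  by_cases h : 0 ≤ A * (p + a) + B
  · have h2 := mul_nonneg (sub_nonneg.mpr hap) h
    have : A * a ^ 2 + B * a + C ≤ A * p ^ 2 + B * p + C := by linarith
    exact le_trans (min_le_left _ _) this
  · rw [not_le] at h
    have h1 : A * (b - a) ≤ 0 := mul_nonpos_iff.mpr (Or.inr ⟨hA, sub_nonneg.mpr (hap.trans hpb)⟩)
    have h' : A * (p + b) + B < 0 := by linarith
    have h2 := mul_nonneg (sub_nonneg.mpr hpb) (neg_nonneg.mpr h'.le)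
    have : A * b ^ 2 + B * b + C ≤ A * p ^ 2 + B * p + C := by linarith
    exact le_trans (min_le_right _ _) this

/-- **FAR-Γ-SIDE CONVEXITY.** For `−1/2 < t′ < 0` and `−4 − 4t′ < μ < μ_c(t′)` the curvature numerator is POSITIVE at every point
of the Fermi curve `{ε_{t′} = μ}`: `Q_{t′,μ}` is concave, positive at the axis value `1 + d_ax` and at the diagonal value `2c_d` of
`p = cos k₀ + cos k₁`, and every curve point has `p` in between. [folklore] -/
theorem farGamma_curvNum_pos {tp μ : ℝ} (htp1 : -1 / 2 < tp) (htp0 : tp < 0) (hbot : -4 - 4 * tp < μ)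
    (hμc : μ < convexityReturnLevel tp) {k : Momentum} (hε : squareDispersion 1 tp k = μ) :
    0 < curvNum tp (k 0) (k 1) := by
  have htp : |tp| < 1 / 2 := abs_lt.mpr ⟨by linarith, by linarith⟩
  have htp0' : tp ≠ 0 := htp0.ne
  have h12 : 0 < 1 + 2 * tp := by linarith
  have h12' : 1 + 2 * tp ≠ 0 := h12.ne'
  have h2tp : 2 * tp ≤ 0 := by linarith
  have h14 : 0 < 1 - 4 * tp ^ 2 := by
    have := mul_pos h12 (by linarith : (0:ℝ) < 1 - 2 * tp)
    linarith
  have hvh : μ < 4 * tp := hμc.trans (convexityReturnLevel_lt_vanHove htp1 htp0)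
  have htp2 : 0 < tp ^ 2 := lt_of_le_of_ne (sq_nonneg tp) (Ne.symm (pow_ne_zero 2 htp0'))
  have hΛ := hyperbola_of_level hε
  have hc1 : cos (k 0) ≤ 1 := cos_le_one _
  have hd1 : cos (k 1) ≤ 1 := cos_le_one _
  have ha : 0 < 1 + 2 * tp * cos (k 0) := one_add_two_tp_cos_pos htp _
  have hb : 0 < 1 + 2 * tp * cos (k 1) := one_add_two_tp_cos_pos htp _
  have hΛpos : 0 < 1 - tp * μ := one_sub_tp_mul_level_pos htp hε
  have hΛlo : (1 + 2 * tp) ^ 2 < 1 - tp * μ := by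
    have := mul_neg_of_neg_of_pos htp0 (by linarith : 0 < 4 + 4 * tp + μ)
    linarith
  have hΛvh : 1 - tp * μ < 1 - 4 * tp ^ 2 := by
    have := mul_neg_of_neg_of_pos htp0 (sub_pos.mpr hvh)
    linarith
  have hΛc : 1 - tp * μ < (1 - 4 * tp ^ 2) ^ 2 := by
    unfold convexityReturnLevel at hμc
    have := mul_neg_of_neg_of_pos htp0 (by linarith : 0 < 8 * tp - 16 * tp ^ 3 - μ)
    linarith
  -- (1) the axis value `p_ax = 1 + d_ax`: the curve point `(0, arccos d_ax)`
  set dax : ℝ := ((1 - tp * μ) / (1 + 2 * tp) - 1) / (2 * tp) with hdax_def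
  have hax : (1 + 2 * tp * 1) * (1 + 2 * tp * dax) = 1 - tp * μ := by
    rw [hdax_def]
    field_simp
    ring
  have hdax1 : dax < 1 := by
    by_contra h
    rw [not_lt] at h
    have h1 := mul_le_mul_of_nonpos_left h h2tp
    have h2 := mul_le_mul_of_nonneg_left (by linarith : 1 + 2 * tp * dax ≤ 1 + 2 * tp) h12.le
    linarith
  have hdaxm : -1 < dax := by
    by_contra h
    rw [not_lt] at h
    have h1 := mul_le_mul_of_nonpos_left h h2tp
    have h2 := mul_le_mul_of_nonneg_left (by linarith : 1 - 2 * tp ≤ 1 + 2 * tp * dax) h12.le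
    linarith
  have hQax : 0 < klQ tp μ (1 + dax) := by
    have hG := klG_on_hyperbola hax
    have hGv : klG tp 1 dax = (1 + 2 * tp) * (1 - dax ^ 2) := by unfold klG; ring
    have h1 : 0 < 1 - dax ^ 2 := by
      have := mul_pos (sub_pos.mpr hdax1) (by linarith : 0 < 1 + dax)
      linarith
    rw [← hG, hGv]
    exact mul_pos (mul_pos (by norm_num) htp2) (mul_pos h12 h1)
  -- (2) the diagonal value `p_d = 2c_d`: the curve point `(arccos c_d, arccos c_d)`
  set r : ℝ := Real.sqrt (1 - tp * μ) with hr_def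
  have hr0 : 0 ≤ r := Real.sqrt_nonneg _
  have hr2 : r ^ 2 = 1 - tp * μ := Real.sq_sqrt hΛpos.le
  have hr_lo : 1 + 2 * tp < r := by
    by_contra h
    rw [not_lt] at h
    have := mul_le_mul h h hr0 h12.le
    linarith
  have hr_hi : r < 1 - 4 * tp ^ 2 := by
    by_contra h
    rw [not_lt] at h
    have := mul_le_mul h h h14.le hr0
    linarith
  set cd : ℝ := (r - 1) / (2 * tp) with hcd_def
  have hcd : 1 + 2 * tp * cd = r := by
    rw [hcd_def]
    field_simp
    ring
  have hdiag : (1 + 2 * tp * cd) * (1 + 2 * tp * cd) = 1 - tp * μ := by rw [hcd, ← hr2]; ring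
  have hcd1 : cd < 1 := by
    by_contra h
    rw [not_lt] at h
    have := mul_le_mul_of_nonpos_left h h2tp
    linarith
  have hcds : 0 < cd + 2 * tp := by
    by_contra h
    rw [not_lt] at h
    have := mul_le_mul_of_nonpos_left h h2tp
    linarith
  have hcdm : -1 < cd := by linarith
  have hQd : 0 < klQ tp μ (cd + cd) := by
    have hG := klG_on_hyperbola hdiag
    have hGv : klG tp cd cd = 2 * ((cd + 2 * tp) * (1 - cd ^ 2)) := by unfold klG; ring
    have h1 : 0 < 1 - cd ^ 2 := by
      have := mul_pos (sub_pos.mpr hcd1) (by linarith : 0 < 1 + cd)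
      linarith
    rw [← hG, hGv]
    exact mul_pos (mul_pos (by norm_num) htp2) (mul_pos two_pos (mul_pos hcds h1))
  -- (3) the range `p_ax ≤ p ≤ p_d` of `p = cos k₀ + cos k₁` on the curve
  have hp_lo : 1 + dax ≤ cos (k 0) + cos (k 1) := by
    have hkey : (1 + 2 * tp) * (2 * tp) * (dax + 1 - cos (k 0) - cos (k 1))
        = (2 * tp) ^ 2 * ((1 - cos (k 0)) * (1 - cos (k 1))) := by
      linear_combination hax - hΛ
    have hnn : 0 ≤ (2 * tp) ^ 2 * ((1 - cos (k 0)) * (1 - cos (k 1))) :=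
      mul_nonneg (sq_nonneg _) (mul_nonneg (sub_nonneg.mpr hc1) (sub_nonneg.mpr hd1))
    by_contra h
    rw [not_le] at h
    have hlt : (1 + 2 * tp) * (2 * tp) * (dax + 1 - cos (k 0) - cos (k 1)) < 0 :=
      mul_neg_of_neg_of_pos (mul_neg_of_pos_of_neg h12 (by linarith)) (by linarith)
    linarith
  have hp_hi : cos (k 0) + cos (k 1) ≤ cd + cd := by
    have hsum : 2 * r ≤ (1 + 2 * tp * cos (k 0)) + (1 + 2 * tp * cos (k 1)) := by
      by_contra h
      rw [not_le] at h
      have h3 : 0 < 2 * r + ((1 + 2 * tp * cos (k 0)) + (1 + 2 * tp * cos (k 1))) := by linarith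
      have h4 := mul_pos (sub_pos.mpr h) h3
      have h5 := sq_nonneg ((1 + 2 * tp * cos (k 0)) - (1 + 2 * tp * cos (k 1)))
      linarith
    by_contra h
    rw [not_le] at h
    have hneg := mul_neg_of_neg_of_pos htp0 (sub_pos.mpr h)
    linarith
  -- (4) concavity of `Q`
  have hA : 2 * tp * (1 - 4 * tp ^ 2) ≤ 0 := (mul_neg_of_neg_of_pos (by linarith) h14).le
  have e : ∀ q, klQ tp μ q = 2 * tp * (1 - 4 * tp ^ 2) * q ^ 2 + -(klM tp μ) * q + 4 * tp * klM tp μ := by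
    intro q; unfold klQ; ring
  have hmin := quad_ge_min_of_concave (A := 2 * tp * (1 - 4 * tp ^ 2)) (B := -(klM tp μ)) (C := 4 * tp * klM tp μ)
    hA hp_lo hp_hi
  have hQp : 0 < klQ tp μ (cos (k 0) + cos (k 1)) := by
    rw [e] at hQax hQd ⊢
    exact lt_of_lt_of_le (lt_min hQax hQd) hmin
  have h := curvNum_on_fermiCurve hε
  have hposQ : 0 < 2 * (1 - tp * μ) * klQ tp μ (cos (k 0) + cos (k 1)) := mul_pos (mul_pos two_pos hΛpos) hQp
  by_contra hN
  rw [not_lt] at hN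
  have := mul_nonneg htp2.le (neg_nonneg.mpr hN)
  linarith

/-- Far Γ side ⇒ the typed side condition `KLCurvSignConstantTP` (constant POSITIVE sign). [folklore] -/
theorem farGamma_curvSignConstant {tp μ : ℝ} (htp1 : -1 / 2 < tp) (htp0 : tp < 0) (hbot : -4 - 4 * tp < μ)
    (hμc : μ < convexityReturnLevel tp) : KLCurvSignConstantTP tp μ :=
  Or.inl fun _ hk => farGamma_curvNum_pos htp1 htp0 hbot hμc hk.2

/-- **FAR-Γ-SIDE FERMI-LIQUID ELIGIBILITY**: FST II (A3) holds in the electron orientation `e = ε_{t′} − μ`. [folklore] -/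
theorem farGamma_hypA3 {tp μ : ℝ} (htp1 : -1 / 2 < tp) (htp0 : tp < 0) (hbot : -4 - 4 * tp < μ)
    (hμc : μ < convexityReturnLevel tp) : FermiRG.HypA3 (fun q : Momentum => squareDispersion 1 tp q - μ) :=
  hypA3_of_curvNum_pos fun _ hε => farGamma_curvNum_pos htp1 htp0 hbot hμc hε

/-! #### §5d  The complete chart and the scan rows -/

/-- **THE COMPLETE CONVEXITY CHART of the `t`–`t′` Fermi curve** (`−1/2 < t′ < 0`): constant curvature sign below `μ_c(t′)`,
inflection on `(μ_c(t′), 4t′)`, constant sign above `4t′` (up to `4t′ + 32|t′|(1 − 4t′²)`, beyond every scan level). [folklore] -/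
theorem convexityChart {tp μ : ℝ} (htp1 : -1 / 2 < tp) (htp0 : tp < 0) :
    (-4 - 4 * tp < μ → μ < convexityReturnLevel tp → KLCurvSignConstantTP tp μ) ∧
    (convexityReturnLevel tp < μ → μ < 4 * tp → KLInflectionTP tp μ ∧ ¬ KLCurvSignConstantTP tp μ) ∧
    (4 * tp < μ → μ - 4 * tp < 32 * |tp| * (1 - 4 * tp ^ 2) → KLCurvSignConstantTP tp μ) :=
  ⟨fun hbot hμc => farGamma_curvSignConstant htp1 htp0 hbot hμc,
    fun hlo hhi => ⟨gammaSide_inflection htp1 htp0 hlo hhi,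
      not_curvSignConstant_of_inflection (gammaSide_inflection htp1 htp0 hlo hhi)⟩,
    fun hvh hdisc => Mside_curvSignConstant htp1 htp0 hvh hdisc⟩

/-- Scan row `t′ = −0.3`, M side: every level `μ ∈ (−1.2, 0)` — this covers the certified brackets of the cells `δ ∈ {0.05, …, 0.25}`
(margin-1 `mu_brackets_tp.json` b33681f1bfe37622), in particular the director's first `t′` target `(δ, t′) = (1/8, −0.3)`,
`μ ∈ [−0.959607, −0.959599]` — has constant (negative) curvature sign and satisfies FST II (A3) in the hole orientation. [folklore] -/
theorem Mside_row_tpm03 {μ : ℝ} (hμ : μ ∈ Set.Ioo (-6 / 5 : ℝ) 0) :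
    KLCurvSignConstantTP (-3 / 10) μ ∧ FermiRG.HypA3 (fun q : Momentum => -(squareDispersion 1 (-3 / 10) q - μ)) := by
  obtain ⟨h1, h2⟩ := hμ
  have hdisc : μ - 4 * (-3 / 10 : ℝ) < 32 * |(-3 / 10 : ℝ)| * (1 - 4 * (-3 / 10 : ℝ) ^ 2) := by
    rw [abs_of_neg (by norm_num)]; nlinarith
  exact ⟨Mside_curvSignConstant (by norm_num) (by norm_num) (by linarith) hdisc,
    Mside_hypA3_neg (by norm_num) (by norm_num) (by linarith) hdisc⟩

/-- Scan row `t′ = −0.2`, M side: every level `μ ∈ (−0.8, 0)` (cells `δ ∈ {0.05, …, 0.15}`, e.g. `(1/8, −0.2)`: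
`μ ∈ [−0.736652, −0.736636]`). [folklore] -/
theorem Mside_row_tpm02 {μ : ℝ} (hμ : μ ∈ Set.Ioo (-4 / 5 : ℝ) 0) :
    KLCurvSignConstantTP (-2 / 10) μ ∧ FermiRG.HypA3 (fun q : Momentum => -(squareDispersion 1 (-2 / 10) q - μ)) := by
  obtain ⟨h1, h2⟩ := hμ
  have hdisc : μ - 4 * (-2 / 10 : ℝ) < 32 * |(-2 / 10 : ℝ)| * (1 - 4 * (-2 / 10 : ℝ) ^ 2) := by
    rw [abs_of_neg (by norm_num)]; nlinarith
  exact ⟨Mside_curvSignConstant (by norm_num) (by norm_num) (by linarith) hdisc,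
    Mside_hypA3_neg (by norm_num) (by norm_num) (by linarith) hdisc⟩

/-- Scan row `t′ = −0.1`, M side: every level `μ ∈ (−0.4, 0)` (cells `δ ∈ {0.05, 0.075}`). [folklore] -/
theorem Mside_row_tpm01 {μ : ℝ} (hμ : μ ∈ Set.Ioo (-2 / 5 : ℝ) 0) :
    KLCurvSignConstantTP (-1 / 10) μ ∧ FermiRG.HypA3 (fun q : Momentum => -(squareDispersion 1 (-1 / 10) q - μ)) := by
  obtain ⟨h1, h2⟩ := hμ
  have hdisc : μ - 4 * (-1 / 10 : ℝ) < 32 * |(-1 / 10 : ℝ)| * (1 - 4 * (-1 / 10 : ℝ) ^ 2) := by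
    rw [abs_of_neg (by norm_num)]; nlinarith
  exact ⟨Mside_curvSignConstant (by norm_num) (by norm_num) (by linarith) hdisc,
    Mside_hypA3_neg (by norm_num) (by norm_num) (by linarith) hdisc⟩

/-- Scan row `t′ = −0.1`, far Γ side: every level `μ ∈ (−3.6, −0.784)` (cells `δ ∈ {0.275, …, 0.35}`, brackets inside
`[−1.001253, −0.795862]`) has constant (positive) curvature sign and satisfies FST II (A3) in the electron orientation. [folklore] -/
theorem farGamma_row_tpm01 {μ : ℝ} (hμ : μ ∈ Set.Ioo (-18 / 5 : ℝ) (-98 / 125)) :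
    KLCurvSignConstantTP (-1 / 10) μ ∧ FermiRG.HypA3 (fun q : Momentum => squareDispersion 1 (-1 / 10) q - μ) := by
  obtain ⟨h1, h2⟩ := hμ
  have hμc : μ < convexityReturnLevel (-1 / 10) := by rw [convexityReturnLevel_m01]; linarith
  exact ⟨farGamma_curvSignConstant (by norm_num) (by norm_num) (by linarith) hμc,
    farGamma_hypA3 (by norm_num) (by norm_num) (by linarith) hμc⟩

/-- The director's first `t′` target `(δ, t′) = (1/8, −0.3)` on its certified bracket: FST II (A3) holds (hole orientation). [folklore] -/
theorem hypA3_cell_d0125_tpm03 {μ : ℝ} (hμ : μ ∈ Set.Icc (-0.959607 : ℝ) (-0.959599)) :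
    FermiRG.HypA3 (fun q : Momentum => -(squareDispersion 1 (-3 / 10) q - μ)) :=
  (Mside_row_tpm03 ⟨by linarith [hμ.1], by linarith [hμ.2]⟩).2

end Summit.HubbardSuperconductivity.HubbardSuperconductivity.Theorems.KlTPrimeConvexity

end
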